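import Literature.NumberTheory.Automorphic.ShimuraCurveRibetTakahashi
import Literature.NumberTheory.Automorphic.ShimuraParametrizationSplitCaseProofs
import Literature.NumberTheory.EllipticCurves.ModularCurveManinSemistableBridgeProofs
import Literature.NumberTheory.EllipticCurves.NewformsMultiplicityOneProofs
import Literature.NumberTheory.EllipticCurves.ComplexMultiplicationLFunctionIsogenyHoldsProofs
import Literature.NumberTheory.EllipticCurves.DivisionPolynomialTorsion
import Literature.NumberTheory.EllipticCurves.EichlerShimuraConstruction
import Literature.NumberTheory.EllipticCurves.IsogenyFrobeniusTraceHoldsProofs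
import HarnessLib

/-!
# Shimura-curve parametrisations at `D = 1` have degree `[Λ : c Λ_f] · δ_{1,N}`: Pasten's
# "`X₀^1(N) = X₀(N)`" for the tree's two renderings of `δ_{1,N}`, proved

Topic `NumberTheory/Automorphic`; theorems only (no definition, no named fact, no instance; D-0026).
A sibling of `ShimuraParametrizationSplitCaseProofs` (which transports the newform of `W` from
`X₀(M)` to an arbitrary presentation `Γ₀^1(M) = ι(O¹)` of level `(1, M)`, for the EXISTENCE of
Shimura-curve data at `D = 1`). This file transports in BOTH directions WITH THE DEGREE, and proves
the `D = 1` bridge between the tree's two renderings of Pasten's `δ_{1,N}` (H. Pasten, *Shimura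
curves and the abc conjecture*, J. Number Theory 254 (2024) = arXiv:1705.09251, §2 p. 12: "We will
write `X₀^1(N) = X₀(N)`", "the Eichler–Shimura construction gives an optimal quotient
`q_{1,N} : J₀(N) → A_{1,N}` … The composition `φ = q_{1,N} j_N : X₀(N) → A_{1,N}` is well-known to
have degree `δ_{1,N}`"; module docstring of `ShimuraCurveRibetTakahashi.lean`, "Rendering of
`δ_{1,N}` and `δ_{D,M}`"):

* classically, `δ_{1,N}` is `D₁.modularDegree` for a classical datum
  `D₁ : ModularParametrizationData W₁ N` carrying the newform of `W` and of minimal degree among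
  all data at level `N` with that newform (the idiom of `PastenShimura2024_thm_5_5`,
  `PastenShimura2024_thm_6_1`, `PastenShimura2024_cor_10_2`, …);
* on the Shimura side at `D = 1`, it is `deg P` (`=: δ^{Sh}_{1,N}`) for a Shimura datum `P` on an
  `X : ShimuraCurveData 1 N` (any Eichler order of level `N` in the split quaternion algebra, any
  real splitting: `Γ = ι(O¹)` is conjugate to `Γ₀(N)`) realising the class-minimal degree of `W`
  (`ShimuraParametrizationData.IsMinimalFor`).

The three Pasten facts of `ShimuraCurveRibetTakahashi.lean` built on Prop. 6.13 are assembled in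
the tree (`ShimuraCurveRibetTakahashi{Numerator,Assembly,Denominator,DenominatorAssembly,Cokernel}Proofs`)
modulo a bridge hypothesis `h0` between the two: `δ_{1,N} ∣ δ^{Sh}_{1,N}` for the numerator
statement, `δ^{Sh}_{1,N} ∣ δ_{1,N}` (in the classes (b.1)/(b.2)) for part (b). Both are PROVED
here, unconditionally (`ShimuraParametrizationData.modularDegree_dvd_deg`,
`ShimuraParametrizationData.IsMinimalFor.deg_eq_modularDegree`).

What is proved (sorry-free):

* `exists_shimuraParametrizationData_deg_eq_modularDegree` — **classical → Shimura, with the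
  degree**: every classical datum `D : ModularParametrizationData W N` yields, on every
  `X : ShimuraCurveData 1 N`, a Shimura datum of `W` of degree `deg D` (the form
  `c · 2πi · (f ∣[2] h⁻¹)` on `Γ₀^1(N) = h Γ₀(N) h⁻¹`, the split-case transport of
  `ShimuraParametrizationSplitCaseProofs`, with the datum's own uniformisation and fibre count);
* `ShimuraCurveData.exists_cuspForm_gamma0_coe_eq_slash`, `coe_heckeT_eq_smul_of_heckeFun_eq`,
  `forall_mul_mem_of_hasPeriodsIn`, `ShimuraParametrizationData.finite_setOf_natCard_fiberOrbits_ne_of_coe_eq`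
  — **Shimura → classical**: the form `F ∣[2] h ∈ S₂(Γ₀(N))` of a datum, its Hecke condition, its
  periods (`c Λ_f ⊆ Λ`) and its fibre count read on `Y₀(N)`;
* `ShimuraParametrizationData.exists_deg_eq_card_ker_mul_modularDegree` — **the degree formula**
  `deg P = [Λ_{W'} : c Λ_f] · δ_{1,N}` for every Shimura datum `P` at `D = 1` of a curve `W'` of the
  class, via Atkin–Lehner's Multiplicity One theorem (Knapp Thm. 9.22, the tree's THEOREM
  `mem_span_of_equiv_of_mem_newSubspace0`) and the degree calculus of the tree's
  `ModularCurveManinSemistableProofs` (`finite_setOf_natCard_fiber_comp_ne`, `exists_optimalDatum'`);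
* `ShimuraParametrizationData.modularDegree_dvd_deg` — hence **`δ_{1,N} ∣ deg P`** for every such
  `P` (the numerator bridge `h0` of `ShimuraCurveRibetTakahashiNumeratorProofs`, for all data of the
  class, minimal or not);
* `ShimuraParametrizationData.IsMinimalFor.deg_le_modularDegree` — **`δ^{Sh}_{1,N} ≤ δ_{1,N}`** by
  the classical → Shimura transport (`W ∼ W₁` by Faltings, the tree's THEOREM
  `WeierstrassCurve.isIsogenous_iff_frobeniusTrace_eq_holds` through `IsNewformOf.isIsogenous`);
* `ShimuraParametrizationData.IsMinimalFor.deg_eq_modularDegree` — **`δ^{Sh}_{1,N} = δ_{1,N}`**, and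
  `IsMinimalFor.deg_dvd_modularDegree`, the part-(b) bridge `h0` of
  `ShimuraCurveRibetTakahashi{Denominator,DenominatorAssembly,Cokernel}Proofs` (in every class).

The consumers — the assemblies of `PastenShimura2024_thm_6_1`, `PastenShimura2024_thm_6_1_b` and
`PastenShimura2024_pairwise_denominator` with `h0` discharged — are in
`ShimuraCurveRibetTakahashiPairwiseDenominatorProofs.lean`.

## References

* H. Pasten, *Shimura curves and the abc conjecture*, J. Number Theory 254 (2024) 214–335 =
  arXiv:1705.09251, §2 p. 12, §4.8 p. 15, §5.3 p. 17 (held arXiv text, read). [PastenShimura2024]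
* A. W. Knapp, *Elliptic curves*, Math. Notes 40, Princeton 1993, Thm. 9.22 (§IX.7 p. 283),
  Prop. 12.9 (a) and p. 302. [Knapp1993]
* F. Diamond, J. Shurman, *A first course in modular forms*, GTM 228 (2005), Prop. 5.2.1, §3.1,
  §6.1. [DiamondShurman2005]
* J. H. Silverman, *The arithmetic of elliptic curves*, 2nd ed., Thm. VI.4.1. [SilvermanAEC2009]
* Ju. I. Manin, *Parabolic points and zeta functions of modular curves* (1972), Prop. 1.4. [Manin1972]
* G. Faltings, Invent. Math. 73 (1983), §5 Kor. 2. [Faltings1983]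

## Mathlib / tree search

Tree (reused): the split-case transport `ShimuraCurveData.exists_conj_of_discr_one`,
`conjAct_inv_smul_Gamma_eq_of_conj`, `exists_cuspForm_coe_eq_of_level_eq`,
`exists_cuspForm_coe_eq_smul_slash`, `segmentIntegral_eq_and_hasPeriodsIn_of_conj`,
`heckeFun_eq_sum_of_conj`, `heckeFun_eq_mul_of_conj`, `card_orbitFibre_eq_of_conj`,
`finite_setOf_card_orbitFibre_ne_of_conj`, `smul_slash_of_det_pos`
(`ShimuraParametrizationSplitCaseProofs`), `finite_setOf_card_orbitFibre_ne_iff`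
(`ShimuraParametrizationExistenceProofs`), `finite_setOf_card_fiberOrbits_ne_iff`
(`ModularParametrization`), `coe_heckeT_gamma0`, `finset_sum_slash`, `IsNewform0.heckeT_eq_coeff_smul`,
`IsNewform0.ne_zero`, `mem_span_of_equiv_of_mem_newSubspace0` (`NewformsMultiplicityOneProofs`),
`eichlerIntegral_smul_sub_holds`, `eichlerShimuraMap`, `mulQuotientMap`,
`natCard_fiber_mulQuotientMap`, `finite_ker_mulQuotientMap`, `discreteTopology_periodLattice_of_mul_mem`,
`exists_basis_span_eq_periodLattice`, `natCard_fiberOrbits_eq`, `finite_setOf_natCard_fiber_comp_ne`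
(`EichlerShimuraMapDegree`), `finite_setOf_natCard_fiber_eichlerShimuraMap_ne`,
`ModularParametrizationData.isogenyMap_ker_eq_bot_iff`, `latticeEq_of_modularDegree_le`,
`finite_setOf_natCard_fiberOrbits_ne` (`ModularCurveManinSemistableProofs`), `exists_optimalDatum'`
(`ModularCurveManinSemistableBridgeProofs`), `LFunction_eq_of_isIsogenous_holds`,
`WeierstrassCurve.infinite_point`, `IsNewformOf.isIsogenous`,
`WeierstrassCurve.isIsogenous_iff_frobeniusTrace_eq_holds`. Mathlib: `CuspForm.translate`,
`QuotientAddGroup.liftEquiv`, `Equiv.subRight`, `Submodule.mem_span_singleton`. Nothing relating the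
degree of a `ShimuraParametrizationData` at `D = 1` to a `ModularParametrizationData` existed
(`lean search 'deg_eq_modularDegree|modularDegree_dvd_deg'`).
-/

noncomputable section

open scoped MatrixGroups ModularForm Pointwise
open UpperHalfPlane ConjAct Matrix.SpecialLinearGroup CongruenceSubgroup

namespace Literature.NumberTheory.Automorphic

open Literature.NumberTheory.EllipticCurves (LFunction_eq_of_isIsogenous_holds)
open Literature.NumberTheory.EllipticCurves.ModularForms
  (ModularParametrizationData IsNewformOf IsNewformOf.isIsogenous Y0 Y0.mk eichlerIntegral
    periodLattice heckeT HeckeIdx heckeRep intGL cuspSymbol cuspCoeff IsNewform0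
    IsNewform0.heckeT_eq_coeff_smul IsNewform0.ne_zero mem_span_of_equiv_of_mem_newSubspace0
    eichlerIntegral_smul_sub_holds eichlerShimuraMap eichlerShimuraMap_mk mulQuotientMap
    mulQuotientMap_mk natCard_fiber_mulQuotientMap finite_ker_mulQuotientMap
    discreteTopology_periodLattice_of_mul_mem exists_basis_span_eq_periodLattice
    natCard_fiberOrbits_eq finite_setOf_natCard_fiber_comp_ne
    finite_setOf_natCard_fiber_eichlerShimuraMap_ne finite_setOf_card_fiberOrbits_ne_iff
    finset_sum_slash coe_heckeT_gamma0)

/-! ## I. From `X₀(N)` to `X₀^1(N)`: a classical datum transports with its degree -/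

/-- **Transport of a classical datum to `X₀^1(N)`, with its degree.** For a Shimura curve datum `X`
of level `(1, N)` — `B ≃ M₂(ℚ)`, `Γ₀^1(N) = ι(O¹) = h Γ₀(N) h⁻¹` with `det h > 0`
(`ShimuraCurveData.exists_conj_of_discr_one`, Vignéras IV §1 ex. 4) — and a classical datum
`D : ModularParametrizationData W N` (`φ(τ') = uniformize (c · 2πi ∫_{i∞}^{τ'} f)` on `Y₀(N)`,
newform `f` of `W`, Manin constant `c`, `c Λ_f ⊆ Λ_W`, degree `deg D`), the form
`F = c · 2πi · (f ∣[2] h⁻¹) ∈ S₂(Γ₀^1(N))` has periods in `Λ_W`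
(`segmentIntegral_eq_and_hasPeriodsIn_of_conj`), satisfies `T_ℓ F = a_ℓ(W) F` for primes `ℓ ∤ N`
(`heckeFun_eq_mul_of_conj`, `T_ℓ f = a_ℓ(f) f`, Diamond–Shurman Prop. 5.8.5), and
`Γ₀^1(N)τ ↦ uniformize (∫_{τ₀}^τ F) = φ(h⁻¹τ) − φ(h⁻¹τ₀)` has, over all but finitely many points
of `W(ℂ)`, exactly `deg D` orbits in its fibre (`finite_setOf_card_orbitFibre_ne_of_conj` along the
bijection `Γ₀^1(N)∖ℍ → Y₀(N)`, `finite_setOf_card_orbitFibre_ne_iff` along the translation of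
`W(ℂ)`). So `W` has a Shimura datum on `X` of degree `deg D` (same lattice and uniformisation):
Pasten's "`X₀^1(N) = X₀(N)`" (§2 p. 12) for an ARBITRARY presentation `(B, O, ι)`, degree included
(the tree's `automorphicHalf_one_of_isNewformOf` transports the newform with SOME degree).
[cite: PastenShimura2024, §2 p. 12 (X₀^1(N) = X₀(N)) and §5.3 p. 17] [cite: DiamondShurman2005, Prop. 5.2.1 and Prop. 5.8.5] -/
theorem exists_shimuraParametrizationData_deg_eq_modularDegree {N : ℕ} [NeZero N]
    (X : ShimuraCurveData 1 N) {W : WeierstrassCurve ℚ} (Dc : ModularParametrizationData W N) :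
    ∃ P : ShimuraParametrizationData X W, P.deg = Dc.modularDegree := by
  obtain ⟨-, h, hdet, H⟩ := X.exists_conj_of_discr_one
  have hΓ := X.conjAct_inv_smul_Gamma_eq_of_conj H
  obtain ⟨F, hF⟩ :=
    X.exists_cuspForm_coe_eq_smul_slash hΓ Dc.f ((Dc.c : ℂ) * (2 * Real.pi * Complex.I))
  have hcΛ' : ∀ z ∈ periodLattice Dc.f, (Dc.c : ℂ) * z ∈ Dc.L.lattice.toAddSubgroup := fun z hz =>
    (Submodule.mem_toAddSubgroup _).mpr (Dc.smul_periodLattice_le z hz)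
  obtain ⟨hseg, hper⟩ :=
    X.segmentIntegral_eq_and_hasPeriodsIn_of_conj hdet hΓ Dc.f (Dc.c : ℂ) F hF hcΛ'
  set τ₀ : ℍ := UpperHalfPlane.I
  set K : ℂ := (Dc.c : ℂ) * eichlerIntegral Dc.f (h⁻¹ • τ₀) with hK
  -- the fibre count of `Dc`, transported from `Y₀(N)` and translated by `uniformize K`
  have hfin : {Pt : (W.baseChange ℂ).toAffine.Point |
      Nat.card {y : MulAction.orbitRel.Quotient X.Gamma ℍ // ∃ τ : ℍ,
        (Quotient.mk _ τ : MulAction.orbitRel.Quotient X.Gamma ℍ) = y ∧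
          Dc.uniformize (segmentIntegral F τ₀ τ) = Pt} ≠ Dc.deg}.Finite := by
    set e : (W.baseChange ℂ).toAffine.Point ≃ (W.baseChange ℂ).toAffine.Point :=
      Equiv.subRight (Dc.uniformize K) with he
    have hfin' := (finite_setOf_card_orbitFibre_ne_iff (Y0.mk N) e
      (fun τ : ℍ => Dc.uniformize ((Dc.c : ℂ) * eichlerIntegral Dc.f τ)) Dc.deg).mpr Dc.deg_spec
    refine X.finite_setOf_card_orbitFibre_ne_of_conj hΓ
      (fun τ : ℍ => e (Dc.uniformize ((Dc.c : ℂ) * eichlerIntegral Dc.f τ)))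
      (fun τ : ℍ => Dc.uniformize (segmentIntegral F τ₀ τ)) (fun τ => ?_) Dc.deg hfin'
    simp only [he, Equiv.subRight_apply, hseg, hK, map_sub]
  refine ⟨{ L := Dc.L
            isNeronLattice := Dc.isNeronLattice
            uniformize := Dc.uniformize
            ker_uniformize := Dc.ker_uniformize
            uniformize_surjective := Dc.uniformize_surjective
            uniformize_spec := Dc.uniformize_spec
            form := F
            basePoint := τ₀
            period_mem := by simpa only [Submodule.coe_toAddSubgroup] using hper
            hecke_eq := fun ℓ hℓ hℓM => ?_
            deg := Dc.deg
            deg_pos := Dc.deg_pos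
            deg_spec := hfin }, rfl⟩
  haveI : NeZero ℓ := ⟨hℓ.ne_zero⟩
  have hℓM' : ¬ ℓ ∣ N := by simpa using hℓM
  have hT : (⇑(heckeT (Gamma0 N) 2 ℓ Dc.f) : ℍ → ℂ) = ((W.LFunction ℓ : ℤ) : ℂ) • ⇑Dc.f := by
    rw [IsNewform0.heckeT_eq_coeff_smul Dc.isNewformOf.1 hℓ, CuspForm.IsGLPos.coe_smul]
    congr 1
    exact Dc.isNewformOf.2 ℓ
  exact X.heckeFun_eq_mul_of_conj H hdet hΓ Dc.f _ F hF hℓ hℓM' hT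

section SplitBack

variable {M : ℕ}

/-! ## II. From `X₀^1(M)` back to `X₀(M)`: form, Hecke condition, periods, fibre count -/

/-- **The form of a datum read on `Γ₀(M)`.** If `h⁻¹ Γ₀^1(M) h = Γ₀(M)` then for a weight-`2` cusp
form `F` on `Γ₀^1(M) = X.Gamma`, `F ∣[2] h` is (the function of) a weight-`2` cusp form on `Γ₀(M)`
(Mathlib `CuspForm.translate`; the converse of the tree's `exists_cuspForm_coe_eq_smul_slash`).
[folklore] -/
theorem ShimuraCurveData.exists_cuspForm_gamma0_coe_eq_slash (X : ShimuraCurveData 1 M)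
    {h : GL (Fin 2) ℝ} (hΓ : toConjAct h⁻¹ • X.Gamma = (Gamma0 M).map (mapGL ℝ))
    (F : CuspForm X.Gamma 2) :
    ∃ G : CuspForm (Gamma0 M) 2, (⇑G : ℍ → ℂ) = ⇑F ∣[(2 : ℤ)] h := by
  obtain ⟨G, hG⟩ := exists_cuspForm_coe_eq_of_level_eq hΓ (CuspForm.translate F h)
  exact ⟨G, hG⟩

/-- **The Hecke condition transports back.** If `G = F ∣[2] h` on `Γ₀(M)` (`Γ₀^1(M) = h Γ₀(M) h⁻¹`,
`det h > 0`) and `T_ℓ F = a F` for the Hecke operator `X.heckeFun ℓ` of the datum (`ℓ` prime,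
`ℓ ∤ M`), then `T_ℓ G = a G` for the classical `T_ℓ` on `S₂(Γ₀(M))`: both are sums over the same
`ℓ + 1` cosets, `h βᵢ h⁻¹` resp. `βᵢ` (the tree's `heckeFun_eq_sum_of_conj`, Diamond–Shurman
Prop. 5.2.1; Pasten §4.8 for `T_{U,n}`), slashed by `h` (the converse of the tree's
`heckeFun_eq_mul_of_conj`). [cite: DiamondShurman2005, Prop. 5.2.1] [cite: PastenShimura2024, §4.8 p. 15 (Hecke action)] -/
theorem ShimuraCurveData.coe_heckeT_eq_smul_of_heckeFun_eq [NeZero M] (X : ShimuraCurveData 1 M)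
    {h : GL (Fin 2) ℝ}
    (H : ∀ m : Matrix (Fin 2) (Fin 2) ℝ, (∃ x ∈ X.O, X.ι x = m) ↔
      ∃ A : Matrix (Fin 2) (Fin 2) ℤ, (M : ℤ) ∣ A 1 0 ∧
        m = (h : Matrix (Fin 2) (Fin 2) ℝ) * A.map (Int.cast : ℤ → ℝ) *
          ((h⁻¹ : GL (Fin 2) ℝ) : Matrix (Fin 2) (Fin 2) ℝ))
    (hdet : 0 < h.det.val) (hΓ : toConjAct h⁻¹ • X.Gamma = (Gamma0 M).map (mapGL ℝ))
    (F : CuspForm X.Gamma 2) (G : CuspForm (Gamma0 M) 2) (hG : (⇑G : ℍ → ℂ) = ⇑F ∣[(2 : ℤ)] h)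
    {ℓ : ℕ} (hℓ : ℓ.Prime) (hℓM : ¬ ℓ ∣ M) {a : ℂ} (hF : X.heckeFun ℓ F = fun τ => a * F τ) :
    (⇑(haveI : NeZero ℓ := ⟨hℓ.ne_zero⟩; heckeT (Gamma0 M) 2 ℓ G) : ℍ → ℂ) = a • ⇑G := by
  haveI : NeZero ℓ := ⟨hℓ.ne_zero⟩
  have hsum : X.heckeFun ℓ F =
      ∑ i : HeckeIdx M ℓ, ⇑F ∣[(2 : ℤ)] (h * intGL (heckeRep ℓ i.1) * h⁻¹) := by
    funext τ
    exact X.heckeFun_eq_sum_of_conj H hΓ hℓ hℓM F τ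
  have hslash : (X.heckeFun ℓ F) ∣[(2 : ℤ)] h =
      (∑ i : HeckeIdx M ℓ, ⇑F ∣[(2 : ℤ)] (h * intGL (heckeRep ℓ i.1) * h⁻¹)) ∣[(2 : ℤ)] h := by
    rw [hsum]
  rw [hF, show (fun τ => a * F τ) = a • (⇑F : ℍ → ℂ) from rfl, smul_slash_of_det_pos hdet,
    finset_sum_slash] at hslash
  rw [coe_heckeT_gamma0 M 2 ℓ hℓ G, hG, hslash]
  refine Finset.sum_congr rfl fun i _ => ?_
  rw [← SlashAction.slash_mul, ← SlashAction.slash_mul, inv_mul_cancel_right]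

/-- **Periods transport back.** If `F = c · 2πi · (f ∣[2] h⁻¹)` on `Γ₀^1(M) = h Γ₀(M) h⁻¹`
(`det h > 0`) has all its periods on `Γ₀^1(M)` in `Λ`, then `c Λ_f ⊆ Λ`: for `γ ∈ Γ₀(M)` the period
of `F` along `h γ h⁻¹ ∈ Γ₀^1(M)` from `h τ` is `c · (EI_f(γτ) − EI_f(τ)) = c · {∞, γ∞}_f`
(`segmentIntegral_eq_and_hasPeriodsIn_of_conj`; the tree's THEOREM `eichlerIntegral_smul_sub_holds`,
Manin 1972 Prop. 1.4), and `Λ_f` is generated by the `{∞, γ∞}_f` (`periodLattice`) (the converse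
of the period clause of `segmentIntegral_eq_and_hasPeriodsIn_of_conj`). [cite: Manin1972, Prop. 1.4] -/
theorem ShimuraCurveData.forall_mul_mem_of_hasPeriodsIn [NeZero M] (X : ShimuraCurveData 1 M)
    {h : GL (Fin 2) ℝ} (hdet : 0 < h.det.val)
    (hΓ : toConjAct h⁻¹ • X.Gamma = (Gamma0 M).map (mapGL ℝ))
    (f : CuspForm (Gamma0 M) 2) (c : ℂ) (F : CuspForm X.Gamma 2)
    (hF : (⇑F : ℍ → ℂ) = (c * (2 * Real.pi * Complex.I)) • (⇑f ∣[(2 : ℤ)] h⁻¹))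
    {Λ : AddSubgroup ℂ} (hper : HasPeriodsIn X.Gamma F (Λ : Set ℂ)) :
    ∀ z ∈ periodLattice f, c * z ∈ Λ := by
  obtain ⟨hseg, -⟩ := X.segmentIntegral_eq_and_hasPeriodsIn_of_conj hdet hΓ f c F hF
    (Λ := ⊤) (fun _ _ => AddSubgroup.mem_top _)
  have hle : periodLattice f ≤ Λ.comap (AddMonoidHom.mulLeft c) := by
    refine (AddSubgroup.closure_le _).mpr ?_
    rintro _ ⟨γ, rfl⟩
    rw [SetLike.mem_coe, AddSubgroup.mem_comap, AddMonoidHom.coe_mulLeft]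
    -- `γ' = h γ h⁻¹ ∈ Γ₀^1(M)`
    have hγ' : h * mapGL ℝ (γ : SL(2, ℤ)) * h⁻¹ ∈ X.Gamma := by
      rw [← mem_conjAct_inv_smul_iff, hΓ]
      exact Subgroup.mem_map_of_mem _ γ.2
    set τ : ℍ := UpperHalfPlane.I
    have hmem := hper _ hγ' (h • τ)
    rw [SetLike.mem_coe, hseg] at hmem
    have h1 : h⁻¹ • (h * mapGL ℝ (γ : SL(2, ℤ)) * h⁻¹) • h • τ = (γ : SL(2, ℤ)) • τ := by
      rw [ModularGroup.sl_moeb, smul_smul, smul_smul,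
        show ((γ : SL(2, ℤ)) : GL (Fin 2) ℝ) = mapGL ℝ (γ : SL(2, ℤ)) from rfl]
      congr 1
      group
    have h2 : h⁻¹ • h • τ = τ := by rw [smul_smul, inv_mul_cancel, one_smul]
    rw [h1, h2, ← mul_sub, eichlerIntegral_smul_sub_holds f γ τ] at hmem
    exact hmem
  intro z hz
  simpa using hle hz

/-- **The fibre count of a datum read on `Y₀(M)`.** If the form of a Shimura-curve datum `P` of
`W'` at level `(1, M)` is `c · 2πi · (f ∣[2] h⁻¹)` (`Γ₀^1(M) = h Γ₀(M) h⁻¹`, `det h > 0`), then the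
classical map `Γ₀(M)τ' ↦ c · 2πi∫_{i∞}^{τ'} f (mod Λ_{W'})` on `Y₀(M)` has exactly `deg P` orbits in
its fibre over all but finitely many classes of `ℂ/Λ_{W'}`: `deg_spec` is moved from `W'(ℂ)` to
`ℂ/Λ_{W'}` along `QuotientAddGroup.liftEquiv` of `P.uniformize`, from `Γ₀^1(M)∖ℍ` to `Y₀(M)` along
`τ' = h⁻¹τ` (`card_orbitFibre_eq_of_conj`, with `∫_{τ₀}^τ F = c EI_f(h⁻¹τ) − c EI_f(h⁻¹τ₀)`), and
translated by the constant `c EI_f(h⁻¹τ₀)` (`finite_setOf_card_fiberOrbits_ne_iff`). [folklore] -/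
theorem ShimuraParametrizationData.finite_setOf_natCard_fiberOrbits_ne_of_coe_eq [NeZero M]
    {X : ShimuraCurveData 1 M} {W' : WeierstrassCurve ℚ} (P : ShimuraParametrizationData X W')
    {h : GL (Fin 2) ℝ} (hdet : 0 < h.det.val)
    (hΓ : toConjAct h⁻¹ • X.Gamma = (Gamma0 M).map (mapGL ℝ))
    (f : CuspForm (Gamma0 M) 2) (c : ℂ)
    (hF : (⇑P.form : ℍ → ℂ) = (c * (2 * Real.pi * Complex.I)) • (⇑f ∣[(2 : ℤ)] h⁻¹)) :
    {Pt : ℂ ⧸ P.L.lattice.toAddSubgroup |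
        Nat.card {y : Y0 M // ∃ τ : ℍ, Y0.mk M τ = y ∧
          ((c * eichlerIntegral f τ : ℂ) : ℂ ⧸ P.L.lattice.toAddSubgroup) = Pt} ≠ P.deg}.Finite := by
  obtain ⟨hseg, -⟩ := X.segmentIntegral_eq_and_hasPeriodsIn_of_conj hdet hΓ f c P.form hF
    (Λ := ⊤) (fun _ _ => AddSubgroup.mem_top _)
  -- Step 1: `deg_spec` on the torus `ℂ/Λ`
  have hker' : P.L.lattice.toAddSubgroup = P.uniformize.ker :=
    SetLike.coe_injective (by rw [Submodule.coe_toAddSubgroup, P.ker_uniformize])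
  let e₁ : ℂ ⧸ P.L.lattice.toAddSubgroup ≃+ (W'.baseChange ℂ).toAffine.Point :=
    QuotientAddGroup.liftEquiv P.L.lattice.toAddSubgroup P.uniformize_surjective hker'
  have he₁ : ∀ x : ℂ, e₁.toEquiv (x : ℂ ⧸ P.L.lattice.toAddSubgroup) = P.uniformize x :=
    fun _ ↦ rfl
  have hfinX : {cl : ℂ ⧸ P.L.lattice.toAddSubgroup |
      Nat.card {y : MulAction.orbitRel.Quotient X.Gamma ℍ // ∃ τ : ℍ,
        (Quotient.mk _ τ : MulAction.orbitRel.Quotient X.Gamma ℍ) = y ∧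
          ((segmentIntegral P.form P.basePoint τ : ℂ) : ℂ ⧸ P.L.lattice.toAddSubgroup) = cl} ≠
        P.deg}.Finite := by
    refine (finite_setOf_card_orbitFibre_ne_iff
      (fun τ : ℍ ↦ (Quotient.mk _ τ : MulAction.orbitRel.Quotient X.Gamma ℍ)) e₁.toEquiv
      (fun τ : ℍ ↦ ((segmentIntegral P.form P.basePoint τ : ℂ) : ℂ ⧸ P.L.lattice.toAddSubgroup))
      P.deg).mp ?_
    simp only [he₁]
    exact P.deg_spec
  -- Step 2: from `Γ₀^1(M)`-orbits to `Y₀(M)`-orbits (translation by the constant `K`)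
  set K : ℂ := c * eichlerIntegral f (h⁻¹ • P.basePoint) with hK
  set e : ℂ ⧸ P.L.lattice.toAddSubgroup ≃ ℂ ⧸ P.L.lattice.toAddSubgroup :=
    Equiv.subRight ((K : ℂ) : ℂ ⧸ P.L.lattice.toAddSubgroup) with he
  have hG : ∀ τ : ℍ,
      ((segmentIntegral P.form P.basePoint τ : ℂ) : ℂ ⧸ P.L.lattice.toAddSubgroup) =
        e (((c * eichlerIntegral f (h⁻¹ • τ) : ℂ) : ℂ ⧸ P.L.lattice.toAddSubgroup)) := fun τ => by
    simp only [he, Equiv.subRight_apply, hseg, hK, QuotientAddGroup.mk_sub]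
  have hcard := fun cl => X.card_orbitFibre_eq_of_conj hΓ
    (fun τ : ℍ => e (((c * eichlerIntegral f τ : ℂ) : ℂ ⧸ P.L.lattice.toAddSubgroup)))
    (fun τ : ℍ => ((segmentIntegral P.form P.basePoint τ : ℂ) : ℂ ⧸ P.L.lattice.toAddSubgroup))
    hG cl
  have hset : {cl : ℂ ⧸ P.L.lattice.toAddSubgroup |
      Nat.card {y : Y0 M // ∃ τ : ℍ, Y0.mk M τ = y ∧
        e (((c * eichlerIntegral f τ : ℂ) : ℂ ⧸ P.L.lattice.toAddSubgroup)) = cl} ≠ P.deg} =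
      {cl : ℂ ⧸ P.L.lattice.toAddSubgroup |
      Nat.card {y : MulAction.orbitRel.Quotient X.Gamma ℍ // ∃ τ : ℍ,
        (Quotient.mk _ τ : MulAction.orbitRel.Quotient X.Gamma ℍ) = y ∧
          ((segmentIntegral P.form P.basePoint τ : ℂ) : ℂ ⧸ P.L.lattice.toAddSubgroup) = cl} ≠
        P.deg} :=
    Set.ext fun cl => by rw [Set.mem_setOf_eq, Set.mem_setOf_eq, hcard cl]
  have hfinY : {cl : ℂ ⧸ P.L.lattice.toAddSubgroup |
      Nat.card {y : Y0 M // ∃ τ : ℍ, Y0.mk M τ = y ∧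
        e (((c * eichlerIntegral f τ : ℂ) : ℂ ⧸ P.L.lattice.toAddSubgroup)) = cl} ≠
        P.deg}.Finite := by
    rw [hset]
    exact hfinX
  -- Step 3: undo the translation
  exact (finite_setOf_card_fiberOrbits_ne_iff e
    (fun τ : ℍ => ((c * eichlerIntegral f τ : ℂ) : ℂ ⧸ P.L.lattice.toAddSubgroup)) P.deg).mp hfinY

/-! ## III. The degree formula `deg P = [Λ_{W'} : c Λ_f] · δ_{1,N}` and the bridge -/

/-- **Degree formula for Shimura-curve data at `D = 1`.** Let `X` be a Shimura curve datum of level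
`(1, N)`, `P` a datum on `X` of an elliptic curve `W'` that is `ℚ`-isogenous to `W`, and `D₁` a
classical datum at level `N` (of any `W₁`) carrying the newform `f` of `W` and of minimal degree
among all data at level `N` with that newform (`δ_{1,N} := deg D₁`). Then there is `c ∈ ℂˣ` with
`c Λ_f ⊆ Λ_{W'}`, the isogeny `z ↦ c z : ℂ/Λ_f → ℂ/Λ_{W'}` has finite kernel, and
`deg P = #ker · δ_{1,N} = [Λ_{W'} : c Λ_f] · δ_{1,N}`. Proof: with `Γ₀^1(N) = h Γ₀(N) h⁻¹`
(`exists_conj_of_discr_one`), `G = P.form ∣[2] h ∈ S₂(Γ₀(N))` satisfies `T_ℓ G = a_ℓ(W') G = a_ℓ(f) G`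
for primes `ℓ ∤ N` (`coe_heckeT_eq_smul_of_heckeFun_eq`, the Hecke condition of `P`, and
`a_ℓ(W') = a_ℓ(W) = a_ℓ(f)` by isogeny invariance of `L(E, s)`, the tree's
`LFunction_eq_of_isIsogenous_holds`), so `G = c' f` by **Atkin–Lehner's Multiplicity One** (Knapp
Thm. 9.22, the tree's THEOREM `mem_span_of_equiv_of_mem_newSubspace0`); hence
`P.form = c · 2πi · (f ∣[2] h⁻¹)`, `c = c'/2πi`, `c Λ_f ⊆ Λ_{W'}` (`forall_mul_mem_of_hasPeriodsIn`),
`c ≠ 0` (else `φ_P` is constant, contradicting `deg_spec` on the infinite `W'(ℂ)`). The map of `P`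
read on `Y₀(N)` (`finite_setOf_natCard_fiberOrbits_ne_of_coe_eq`) is the Eichler–Shimura map
`Y₀(N) → ℂ/Λ_f` followed by `z ↦ c z`; `D₁` is lattice-optimal (`c₁ Λ_f = Λ_{W₁}`: an optimal datum
exists unconditionally, the tree's `exists_optimalDatum'`, and `latticeEq_of_modularDegree_le`,
Knapp Prop. 12.9 (a)), so the Eichler–Shimura map has generic fibre `δ_{1,N}`
(`finite_setOf_natCard_fiber_eichlerShimuraMap_ne`); fibre counts multiply
(`finite_setOf_natCard_fiber_comp_ne`) and two generic fibre counts on the infinite torus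
`ℂ/Λ_{W'}` agree. (Degrees multiply under composition and `deg [z ↦ c z] = [Λ_{W'} : c Λ_f]`:
Diamond–Shurman 2005 §3.1, §6.1; Silverman AEC VI.4.1; Pasten §2 p. 12: "`X₀^1(N) = X₀(N)`", "the
composition `φ = q_{1,N} j_N : X₀(N) → A_{1,N}` is well-known to have degree `δ_{1,N}`".)
[cite: PastenShimura2024, §2 p. 12 (X₀^1(N) = X₀(N), δ_{1,N})] [cite: Knapp1993, Thm. 9.22 and Prop. 12.9(a)] [cite: SilvermanAEC2009, Thm. VI.4.1] -/
theorem ShimuraParametrizationData.exists_deg_eq_card_ker_mul_modularDegree {N : ℕ} [NeZero N]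
    {X : ShimuraCurveData 1 N} {W W' W₁ : WeierstrassCurve ℚ} [W.IsElliptic] [W'.IsElliptic]
    [W₁.IsElliptic] (P : ShimuraParametrizationData X W') (hiso : W.IsIsogenous W')
    (D₁ : ModularParametrizationData W₁ N) (hf : IsNewformOf W D₁.f)
    (hmin : ∀ (W₂ : WeierstrassCurve ℚ) [W₂.IsElliptic] (D₂ : ModularParametrizationData W₂ N),
      D₂.f = D₁.f → D₁.modularDegree ≤ D₂.modularDegree) :
    ∃ (c : ℂ) (hc : ∀ z ∈ periodLattice D₁.f, c * z ∈ P.L.lattice.toAddSubgroup),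
      c ≠ 0 ∧ Finite (mulQuotientMap (periodLattice D₁.f) P.L.lattice.toAddSubgroup c hc).ker ∧
      P.deg = Nat.card (mulQuotientMap (periodLattice D₁.f) P.L.lattice.toAddSubgroup c hc).ker *
        D₁.modularDegree := by
  classical
  obtain ⟨-, h, hdet, H⟩ := X.exists_conj_of_discr_one
  have hΓ := X.conjAct_inv_smul_Gamma_eq_of_conj H
  have hdet' : 0 < (h⁻¹).det.val := by
    rw [map_inv, Units.val_inv_eq_inv_val]
    exact inv_pos.mpr hdet
  -- the form of `P` read on `Γ₀(N)` is an eigenform with the eigenvalues of the newform `f`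
  obtain ⟨G, hG⟩ := X.exists_cuspForm_gamma0_coe_eq_slash hΓ P.form
  set f := D₁.f with hfdef
  have hnf : IsNewform0 f := D₁.isNewformOf.1
  have hf0 : f ≠ 0 := IsNewform0.ne_zero hnf
  have hL : W'.LFunction = W.LFunction := (LFunction_eq_of_isIsogenous_holds W W' hiso).symm
  have hfT : ∀ (p : ℕ) (hp : p.Prime), ¬ p ∣ N →
      (haveI : NeZero p := ⟨hp.ne_zero⟩; heckeT (Gamma0 N) 2 p f) = cuspCoeff f p • f := by
    intro p hp _
    haveI : NeZero p := ⟨hp.ne_zero⟩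
    exact IsNewform0.heckeT_eq_coeff_smul hnf hp
  have hgT : ∀ (p : ℕ) (hp : p.Prime), ¬ p ∣ N →
      (haveI : NeZero p := ⟨hp.ne_zero⟩; heckeT (Gamma0 N) 2 p G) = cuspCoeff f p • G := by
    intro p hp hpN
    haveI : NeZero p := ⟨hp.ne_zero⟩
    have hpN' : ¬ p ∣ 1 * N := by simpa using hpN
    have hcoe := X.coe_heckeT_eq_smul_of_heckeFun_eq H hdet hΓ P.form G hG hp hpN
      (P.hecke_eq p hp hpN')
    apply DFunLike.coe_injective
    rw [hcoe, CuspForm.IsGLPos.coe_smul, hf.2 p, hL]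
  obtain ⟨c', hc'⟩ := Submodule.mem_span_singleton.mp
    (mem_span_of_equiv_of_mem_newSubspace0 (a := fun p => cuspCoeff f p) hf0 hnf.1 hfT G hgT)
  -- so `P.form = c · 2πi · (f ∣[2] h⁻¹)` with `c = c'/(2πi)`
  have h2pi : (2 * Real.pi * Complex.I : ℂ) ≠ 0 := by simp [Real.pi_ne_zero, Complex.I_ne_zero]
  set c : ℂ := c' / (2 * Real.pi * Complex.I) with hcdef
  have hcc' : c * (2 * Real.pi * Complex.I) = c' := div_mul_cancel₀ c' h2pi
  have hF : (⇑P.form : ℍ → ℂ) = (c * (2 * Real.pi * Complex.I)) • (⇑f ∣[(2 : ℤ)] h⁻¹) := by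
    have h1 : (⇑P.form : ℍ → ℂ) = (⇑G) ∣[(2 : ℤ)] h⁻¹ := by
      rw [hG, ← SlashAction.slash_mul, mul_inv_cancel, SlashAction.slash_one]
    rw [hcc', h1, ← hc', CuspForm.IsGLPos.coe_smul, smul_slash_of_det_pos hdet']
  -- periods: `c Λ_f ⊆ Λ_{W'}`
  have hper : HasPeriodsIn X.Gamma P.form ((P.L.lattice.toAddSubgroup : AddSubgroup ℂ) : Set ℂ) := by
    simpa only [Submodule.coe_toAddSubgroup] using P.period_mem
  have hcΛ : ∀ z ∈ periodLattice f, c * z ∈ P.L.lattice.toAddSubgroup :=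
    X.forall_mul_mem_of_hasPeriodsIn hdet hΓ f c P.form hF hper
  -- the torus `ℂ/Λ_{W'} ≃ W'(ℂ)` is infinite
  haveI : (W'.baseChange ℂ).IsElliptic := by rw [WeierstrassCurve.baseChange]; infer_instance
  haveI : Infinite (W'.baseChange ℂ).toAffine.Point := WeierstrassCurve.infinite_point _
  -- `c ≠ 0`: otherwise `φ_P` is constant and `deg_spec` fails on the infinite `W'(ℂ)`
  have hc0 : c ≠ 0 := by
    intro hc0
    have hF0 : (⇑P.form : ℍ → ℂ) = 0 := by rw [hF, hc0, zero_mul, zero_smul]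
    have hseg0 : ∀ τ : ℍ, segmentIntegral P.form P.basePoint τ = 0 := fun τ => by
      rw [hF0]
      simp [segmentIntegral]
    have hsub : {Pt : (W'.baseChange ℂ).toAffine.Point | Pt ≠ 0} ⊆
        {Pt | Nat.card {y : MulAction.orbitRel.Quotient X.Gamma ℍ // ∃ τ : ℍ,
          (Quotient.mk _ τ : MulAction.orbitRel.Quotient X.Gamma ℍ) = y ∧
            P.uniformize (segmentIntegral P.form P.basePoint τ) = Pt} ≠ P.deg} := by
      intro Pt hPt
      simp only [Set.mem_setOf_eq] at hPt ⊢
      haveI : IsEmpty {y : MulAction.orbitRel.Quotient X.Gamma ℍ // ∃ τ : ℍ,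
          (Quotient.mk _ τ : MulAction.orbitRel.Quotient X.Gamma ℍ) = y ∧
            P.uniformize (segmentIntegral P.form P.basePoint τ) = Pt} :=
        ⟨fun ⟨y, τ, _, hτ⟩ => hPt (by rw [← hτ, hseg0, map_zero])⟩
      rw [Nat.card_of_isEmpty]
      exact P.deg_pos.ne
    have huniv : (Set.univ : Set (W'.baseChange ℂ).toAffine.Point).Finite := by
      refine ((P.deg_spec.subset hsub).union (Set.finite_singleton 0)).subset fun Pt _ => ?_
      by_cases hP0 : Pt = 0
      · exact Or.inr hP0
      · exact Or.inl hP0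
    exact Set.infinite_univ huniv
  -- the fibre count of `P` on `Y₀(N)`: `deg P` orbits over all but finitely many classes
  have hfinP := P.finite_setOf_natCard_fiberOrbits_ne_of_coe_eq hdet hΓ f c hF
  -- `D₁` is lattice-optimal (minimal degree), so the Eichler–Shimura map has degree `δ_{1,N}`
  obtain ⟨W₀, hW₀, D₀, hf₀, h₀⟩ := D₁.exists_optimalDatum'
  have hinj₁ : Function.Injective D₁.isogenyMap :=
    (AddMonoidHom.ker_eq_bot_iff _).mp (D₁.isogenyMap_ker_eq_bot_iff.mpr
      (D₁.latticeEq_of_modularDegree_le D₀ hf₀ h₀ (hmin W₀ D₀ hf₀)))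
  have hSfin := finite_setOf_natCard_fiber_eichlerShimuraMap_ne (f := f) D₁.smul_periodLattice_le
    hinj₁ D₁.finite_setOf_natCard_fiberOrbits_ne
  have hS : ∀ Q ∉ {Q : ℂ ⧸ periodLattice f |
      Nat.card {y : Y0 N // eichlerShimuraMap f y = Q} ≠ D₁.modularDegree},
      Nat.card {y : Y0 N // eichlerShimuraMap f y = Q} = D₁.modularDegree := fun Q hQ ↦
    not_not.mp hQ
  -- the isogeny `z ↦ c z : ℂ/Λ_f → ℂ/Λ_{W'}`: finite kernel, all fibres of size `#ker`
  set m := mulQuotientMap (periodLattice f) P.L.lattice.toAddSubgroup c hcΛ with hm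
  haveI := discreteTopology_periodLattice_of_mul_mem f hc0 hcΛ
  obtain ⟨b, hb⟩ := exists_basis_span_eq_periodLattice f hf0
  haveI hfinker : Finite m.ker := finite_ker_mulQuotientMap b hb P.L hcΛ hc0
  have hkpos : 0 < Nat.card m.ker := Nat.card_pos
  have hk : ∀ Pt, Nat.card {Q // m Q = Pt} = Nat.card m.ker := natCard_fiber_mulQuotientMap hc0
  have key := finite_setOf_natCard_fiber_comp_ne (eichlerShimuraMap f) m hk hkpos hSfin hS
    D₁.deg_pos
  -- compare the two generic fibre counts at a class avoiding both exceptional sets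
  have hker' : P.L.lattice.toAddSubgroup = P.uniformize.ker :=
    SetLike.coe_injective (by rw [Submodule.coe_toAddSubgroup, P.ker_uniformize])
  let e₁ : ℂ ⧸ P.L.lattice.toAddSubgroup ≃+ (W'.baseChange ℂ).toAffine.Point :=
    QuotientAddGroup.liftEquiv P.L.lattice.toAddSubgroup P.uniformize_surjective hker'
  haveI : Infinite (ℂ ⧸ P.L.lattice.toAddSubgroup) :=
    Infinite.of_injective e₁.symm e₁.symm.injective
  obtain ⟨Pt, -, hPt⟩ := Set.infinite_univ.exists_notMem_finite (hfinP.union key)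
  simp only [Set.mem_union, Set.mem_setOf_eq, not_or, not_not] at hPt
  obtain ⟨hP₁, hP₂⟩ := hPt
  refine ⟨c, hcΛ, hc0, hfinker, ?_⟩
  rw [← hP₁, ← hP₂]
  exact natCard_fiberOrbits_eq (fun y ↦ m (eichlerShimuraMap f y)) Pt


end SplitBack

/-- **`δ_{1,N} ∣ deg P` — the numerator bridge, for every datum of the class.** For
`X : ShimuraCurveData 1 N`, a Shimura datum `P` on `X` of a curve `W' ∼ W`, and a classical datum
`D₁` at level `N` carrying the newform of `W` and of minimal degree among all data with that
newform (`δ_{1,N}`): `δ_{1,N} ∣ deg P` (`deg P = [Λ_{W'} : c Λ_f] · δ_{1,N}`,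
`exists_deg_eq_card_ker_mul_modularDegree`). At a class-minimal `P` this is exactly the hypothesis
`h0` of `PastenShimura2024_thm_6_1_of_eqSequentially` /
`PastenShimura2024_thm_6_1_of_prop_6_13_of_mazurKenku` (`ShimuraCurveRibetTakahashi{Numerator,Assembly}Proofs`),
which is thereby discharged. [cite: PastenShimura2024, §2 p. 12 (X₀^1(N) = X₀(N), δ_{1,N})] -/
theorem ShimuraParametrizationData.modularDegree_dvd_deg {N : ℕ} [NeZero N]
    {X : ShimuraCurveData 1 N} {W W' W₁ : WeierstrassCurve ℚ} [W.IsElliptic] [W'.IsElliptic]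
    [W₁.IsElliptic] (P : ShimuraParametrizationData X W') (hiso : W.IsIsogenous W')
    (D₁ : ModularParametrizationData W₁ N) (hf : IsNewformOf W D₁.f)
    (hmin : ∀ (W₂ : WeierstrassCurve ℚ) [W₂.IsElliptic] (D₂ : ModularParametrizationData W₂ N),
      D₂.f = D₁.f → D₁.modularDegree ≤ D₂.modularDegree) :
    D₁.modularDegree ∣ P.deg := by
  obtain ⟨c, hc, -, -, hdeg⟩ := P.exists_deg_eq_card_ker_mul_modularDegree hiso D₁ hf hmin
  exact ⟨_, hdeg.trans (mul_comm _ _)⟩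

/-- **`δ^{Sh}_{1,N} ≤ δ_{1,N}`.** A Shimura datum `P` on an `X : ShimuraCurveData 1 N` realising the
class-minimal degree of `W` (`P.IsMinimalFor W`) has degree at most that of ANY classical datum
`D₁ : ModularParametrizationData W₁ N` whose newform is the newform of `W`: `W₁` carries that
newform too (`D₁.isNewformOf`), so `W ∼ W₁` over `ℚ` by Faltings' isogeny theorem — the tree's
THEOREM `WeierstrassCurve.isIsogenous_iff_frobeniusTrace_eq_holds`, through
`IsNewformOf.isIsogenous` — and `D₁` transports to a Shimura datum of `W₁` on `X` of the same degree
(`exists_shimuraParametrizationData_deg_eq_modularDegree`). [cite: PastenShimura2024, §2 p. 12 (X₀^1(N) = X₀(N), δ_{1,N})] [cite: Faltings1983, Kor. 2 zu Satz 4] -/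
theorem ShimuraParametrizationData.IsMinimalFor.deg_le_modularDegree {N : ℕ} [NeZero N]
    {X : ShimuraCurveData 1 N} {W W' W₁ : WeierstrassCurve ℚ} [W.IsElliptic] [W'.IsElliptic]
    [W₁.IsElliptic] {P : ShimuraParametrizationData X W'} (hP : P.IsMinimalFor W)
    (D₁ : ModularParametrizationData W₁ N) (hf : IsNewformOf W D₁.f) :
    P.deg ≤ D₁.modularDegree := by
  obtain ⟨P'', hP''⟩ := exists_shimuraParametrizationData_deg_eq_modularDegree X D₁
  have hiso : W.IsIsogenous W₁ :=
    IsNewformOf.isIsogenous WeierstrassCurve.isIsogenous_iff_frobeniusTrace_eq_holds hf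
      D₁.isNewformOf
  calc P.deg ≤ P''.deg := hP.2 W₁ P'' hiso
    _ = D₁.modularDegree := hP''

/-- **`δ^{Sh}_{1,N} = δ_{1,N}` — the `D = 1` bridge, proved.** For `X : ShimuraCurveData 1 N`, a
class-minimal Shimura datum `P` on `X` for `W` and a classical datum `D₁` at level `N` with the
newform of `W` of minimal degree among all data with that newform: `deg P = deg D₁`
(`deg_le_modularDegree` and `modularDegree_dvd_deg`). Both numbers are Pasten's `δ_{1,N}` (§2
p. 12, `J₀^1(N) = J₀(N)`): the two renderings of `δ_{1,N}` in the tree agree. No hypothesis on `W`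
(conductor, minimality, reduction type) is needed. [cite: PastenShimura2024, §2 p. 12 (δ_{1,N}, X₀^1(N) = X₀(N))] -/
theorem ShimuraParametrizationData.IsMinimalFor.deg_eq_modularDegree {N : ℕ} [NeZero N]
    {X : ShimuraCurveData 1 N} {W W' W₁ : WeierstrassCurve ℚ} [W.IsElliptic] [W'.IsElliptic]
    [W₁.IsElliptic] {P : ShimuraParametrizationData X W'} (hP : P.IsMinimalFor W)
    (D₁ : ModularParametrizationData W₁ N) (hf : IsNewformOf W D₁.f)
    (hmin : ∀ (W₂ : WeierstrassCurve ℚ) [W₂.IsElliptic] (D₂ : ModularParametrizationData W₂ N),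
      D₂.f = D₁.f → D₁.modularDegree ≤ D₂.modularDegree) :
    P.deg = D₁.modularDegree :=
  le_antisymm (hP.deg_le_modularDegree D₁ hf)
    (Nat.le_of_dvd P.deg_pos (P.modularDegree_dvd_deg hP.1 D₁ hf hmin))

/-- **`δ^{Sh}_{1,N} ∣ δ_{1,N}` — the part-(b) bridge.** The hypothesis `h0` of
`PastenShimura2024_thm_6_1_b_of_eqSequentially` and its descendants
(`ShimuraCurveRibetTakahashi{Denominator,DenominatorAssembly,Cokernel}Proofs`; there asked only in
the classes (b.1)/(b.2)), in every class: immediate from `deg_eq_modularDegree`.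
[cite: PastenShimura2024, §2 p. 12 (δ_{1,N}, X₀^1(N) = X₀(N))] -/
theorem ShimuraParametrizationData.IsMinimalFor.deg_dvd_modularDegree {N : ℕ} [NeZero N]
    {X : ShimuraCurveData 1 N} {W W' W₁ : WeierstrassCurve ℚ} [W.IsElliptic] [W'.IsElliptic]
    [W₁.IsElliptic] {P : ShimuraParametrizationData X W'} (hP : P.IsMinimalFor W)
    (D₁ : ModularParametrizationData W₁ N) (hf : IsNewformOf W D₁.f)
    (hmin : ∀ (W₂ : WeierstrassCurve ℚ) [W₂.IsElliptic] (D₂ : ModularParametrizationData W₂ N),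
      D₂.f = D₁.f → D₁.modularDegree ≤ D₂.modularDegree) :
    P.deg ∣ D₁.modularDegree :=
  (hP.deg_eq_modularDegree D₁ hf hmin) ▸ dvd_rfl

end Literature.NumberTheory.Automorphic

end
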